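import Literature.Barriers.NavierStokesRegularity.TaoAveragedBlowup
import Literature.Analysis.FluidPDE.TaoAveragedCascadeHolds
import HarnessLib

/-!
# Barrier `TaoAveragedBlowup` / `TaoAveragedBlowupPrinted` — discharged

Barrier-catalogue glue file for `NavierStokesRegularity` (D-0021) **discharging the barrier entry
`Literature.Barriers.NavierStokesRegularity.TaoAveragedBlowup`** and its definitional synonym
`Literature.Barriers.NavierStokesRegularity.TaoAveragedBlowupPrinted` (`TaoAveragedBlowup.lean`:
T. Tao's Theorem 1.5 as printed — there exist a symmetric averaged Euler bilinear operator
`B̃ : H¹⁰_df(ℝ³) × H¹⁰_df(ℝ³) → H¹⁰_df(ℝ³)*` obeying the cancellation property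
`⟨B̃(u,u), u⟩ = 0` on `H¹⁰_df(ℝ³)` and a Schwartz divergence-free `u₀` such that the averaged
Navier–Stokes equation `∂ₜu = Δu + B̃(u,u)`, `u(0) = u₀` has no global-in-time mild solution
`u : [0,+∞) → H¹⁰_df(ℝ³)`). Both catalogue names are *definitionally* the named fact
`Literature.Analysis.FluidPDE.Tao2016.averagedNS_blowup` (`Literature/Analysis/FluidPDE/TaoAveragedSobolev.lean`;
`taoAveragedBlowup_iff`, `taoAveragedBlowupPrinted_iff`), and that fact is a theorem of the tree:
`Literature.Analysis.FluidPDE.Tao2016.averagedNS_blowup_holds`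
(`Literature/Analysis/FluidPDE/TaoAveragedCascadeHolds.lean`), assembled along the printed proof —
"Theorem 1.5 is then an immediate consequence of [Theorems 3.2 and 3.3]" (§3, p. 14 of
arXiv:1402.0290v3; `averagedNS_blowup_of_cascade`), with Theorem 3.2 (local cascade operators are
averaged Euler operators, §3.1–§3.9) discharged as `localCascade_isAveraged_holds` and Theorem 3.3
(blow-up for a local cascade equation, via Lemma 4.1, Theorem 4.2 and Theorem 6.2 with
Propositions 6.3–6.17) discharged as `localCascade_blowup_holds`. The barrier is therefore an
unconditional theorem (`TaoAveragedBlowup_holds`, `TaoAveragedBlowupPrinted_holds`); its structured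
docstring (technique class, blocks, because, evasions, scope caveats) is unchanged in
`TaoAveragedBlowup.lean`.

Why a sibling file and not an append to `TaoAveragedBlowup.lean`: the catalogue entry imports only
the statement file `TaoAveragedSobolev.lean`, whereas the discharge sits on top of the whole in-tree
reduction chain (`TaoAveragedCascade*`, `TaoCascade*`, `TaoAveragedJointWeight*`, …); keeping the
proof here leaves the entry that routes cite light, as for `SingularSetDimensionBoundHolds.lean` in
this directory.

History: `TaoAveragedBlowupPrinted_holds` landed first (2026-08-15), while the entry
`TaoAveragedBlowup` still carried the older function-level body
(`Literature.Analysis.FluidPDE.tao_averaged_ns_blowup`, deprecated as mis-stated — a different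
statement, which is *not* proved anywhere); once the entry itself was migrated to the printed
statement (verdict clean-up of `TaoAveragedBlowup.lean`, 2026-08-15), `TaoAveragedBlowup_holds` was
appended, so that the catalogue key the routes address is discharged under its own name.

Theorem-only glue module: no definitions, no named facts, no `sorry`.

## References

* T. Tao, *Finite time blowup for an averaged three-dimensional Navier–Stokes equation*,
  J. Amer. Math. Soc. 29 (2016), 601–674 = arXiv:1402.0290v3 (held as `paper:arxiv-1402.0290`;
  numbering of that text): §1.1 Thm. 1.5 (p. 7); §3 p. 14 (Thm. 1.5 ⇐ Thms. 3.2, 3.3).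
  [`Tao2016AveragedNS`]
-/

namespace Literature.Barriers.NavierStokesRegularity

/-- **The barrier `TaoAveragedBlowupPrinted` (Tao 2016, Theorem 1.5 as printed) holds
unconditionally**: there exist a symmetric averaged Euler bilinear operator `B̃` on `H¹⁰_df(ℝ³)`
with the cancellation property `⟨B̃(u,u), u⟩ = 0` and a Schwartz divergence-free `u₀` such that
`∂ₜu = Δu + B̃(u,u)`, `u(0) = u₀` has no global mild solution `u : [0,+∞) → H¹⁰_df(ℝ³)`. The entry
is definitionally `Literature.Analysis.FluidPDE.Tao2016.averagedNS_blowup`, discharged in the tree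
as `averagedNS_blowup_holds` (Thm. 1.5 ⇐ Thm. 3.2 + Thm. 3.3, §3 p. 14, every link proved).
[cite: Tao2016AveragedNS, §1.1 Thm. 1.5] -/
theorem TaoAveragedBlowupPrinted_holds : TaoAveragedBlowupPrinted :=
  Literature.Analysis.FluidPDE.Tao2016.averagedNS_blowup_holds

/-- **The catalogue entry `TaoAveragedBlowup` (Tao 2016, Theorem 1.5 as printed) holds
unconditionally**: there exist a symmetric averaged Euler bilinear operator `B̃` on `H¹⁰_df(ℝ³)`
(an averaging datum as in (1.12)–(1.13)) with the cancellation property (1.16)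
`⟨B̃(u,u), u⟩ = 0` and a Schwartz divergence-free `u₀` such that the averaged Navier–Stokes
equation (1.9) `∂ₜu = Δu + B̃(u,u)`, `u(0) = u₀` has no global mild solution
`u : [0,+∞) → H¹⁰_df(ℝ³)` (1.15). The entry is definitionally
`Literature.Analysis.FluidPDE.Tao2016.averagedNS_blowup` (`taoAveragedBlowup_iff`), discharged in
the tree as `averagedNS_blowup_holds` ("Theorem 1.5 is then an immediate consequence of
[Theorems 3.2 and 3.3]", §3 p. 14; every link of §3.1–§3.9, §4, §6 proved); equivalently
`TaoAveragedBlowupPrinted_holds` transported along `taoAveragedBlowupPrinted_iff_taoAveragedBlowup`.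
[cite: Tao2016AveragedNS, §1.1 Thm. 1.5 (p. 7) and §3 p. 14] -/
theorem TaoAveragedBlowup_holds : TaoAveragedBlowup :=
  Literature.Analysis.FluidPDE.Tao2016.averagedNS_blowup_holds

end Literature.Barriers.NavierStokesRegularity
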